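import Summits.AnomalousDissipation.AnomalousDissipation.Theorems.EnsembleRigidityResidualTransferSSS
import Summits.AnomalousDissipation.AnomalousDissipation.Theorems.MirrorStatisticsLoudTG.Negative.LoadBearing
import HarnessLib

/-!
# Stub `stub_residualK` of line `regimes` (crux `MirrorEnsemble.MirrorStatisticsLoudTG`, stmt-AnomalousDissipation-17693)

RESIDUAL TRANSFER AT THE TAYLOR–GREEN FORCE. Every stationary statistical solution `μ` of
NS_ν(f_TG) on `T³`, `ν > 0`, is a forced-Euler near-statistics with cylindrical defect `≤ ν √G(μ)`:
for every cylindrical test functional `Φ` the forced-Euler generator `v ↦ ⟨f_TG − B(v,v), Φ'(v)⟩`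
is `μ`-integrable and
`|∫ ⟨f_TG − B(v,v), Φ'(v)⟩ dμ| ≤ ν (G(μ))^{1/2} (∫ ‖∇Φ'(v)‖² dμ)^{1/2}`,
`G(μ) = ∫ ‖∇v‖² dμ` the mean enstrophy. This is the instance `f = f_TG ∈ L²` of the landed Euler
defect bound `ResidualTransferSSS.eulerDefect_le`; the hypothesis `Integrable ‖v‖²` of the registered
signature is not needed.

Source: C. Foias, O. Manley, R. Rosa, R. Temam, *Navier–Stokes Equations and Turbulence* (CUP 2001),
Ch. IV §1.2 Def. 1.3, (1.29)–(1.31).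
-/

set_option linter.dupNamespace false

noncomputable section

namespace Summit.AnomalousDissipation.AnomalousDissipation.Theorems.MirrorEnsembleMirrorStatisticsLoudTG

open MeasureTheory
open scoped ENNReal
open Literature.Analysis.FunctionSpaces Literature.Analysis.FluidPDE
open Summit.AnomalousDissipation.AnomalousDissipation.Theorems.TaylorGreenLoudGalerkinStates.Negative (tgForce)
open Summit.AnomalousDissipation.AnomalousDissipation.Theorems.MirrorStatisticsLoudTG.Negative (mirrorClass memLp_tgForce)

/-- Local notation: the energy space `H` of `T³`. -/
local notation "H3" => Torus.energySpace (Fin 3)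

/-- **S1 `stub_residualK`** — RESIDUAL TRANSFER AT f_TG: every stationary statistical solution of
NS_ν(f_TG), `ν > 0`, with integrable energy is a forced-Euler near-statistics with cylindrical defect
`≤ ν√G`: for every cylindrical `Φ` the integrand `v ↦ ⟨f_TG − B(v,v), Φ'(v)⟩` is `μ`-integrable and
`|∫ ⟨f_TG − B(v,v), Φ'(v)⟩ dμ| ≤ ν (G(μ))^{1/2} (∫ ‖∇Φ'(v)‖² dμ)^{1/2}` (FMRT 2001, Ch. IV
(1.29)–(1.31); instance `f = f_TG` of `ResidualTransferSSS.eulerDefect_le`). [folklore] -/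
theorem stub_residualK :
    ∀ (ν : ℝ) (μ : Measure H3), 0 < ν → Torus.IsStationaryStatisticalSolution ν tgForce μ →
      Integrable (fun v : H3 => ‖v‖ ^ 2) μ →
      ∀ Φ : Torus.CylindricalTest (Fin 3),
        Integrable (fun v : H3 => Torus.nsGeneratorPairing 0 tgForce v (Φ.grad v)) μ ∧
          |∫ v, Torus.nsGeneratorPairing 0 tgForce v (Φ.grad v) ∂μ| ≤
            ν * Real.sqrt (Torus.ensembleEnstrophy μ).toReal *
              Real.sqrt (∫ v, Torus.gradNormSq (Φ.grad v) ∂μ) :=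
  fun _ _ hν hμ _ Φ => ResidualTransferSSS.eulerDefect_le hν memLp_tgForce hμ Φ

end Summit.AnomalousDissipation.AnomalousDissipation.Theorems.MirrorEnsembleMirrorStatisticsLoudTG

end
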